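import Summits.ABC.ABC.Theorems.IneffectiveSubspaceDeepRegimeABCRidoutCoreBound
import Summits.ABC.ABC.Theorems.IneffectiveSubspaceDeepRegimeABCStubRoughReduction

/-!
# Stub `stub_ridoutSmallMember` of line `Sketch` — crux `IneffectiveSubspace.DepthCountedABC` (stmt-ABC-14938)

THE RIDOUT STRATUM OF THE T CORE.  Line `Sketch` cuts the crux `DepthCountedABC` (abc with exponent
`1+ε` and one constant `C(K, ε)` on each cell `ω₅(abc) := #{p : v_p(abc) ≥ 5} ≤ K`) into
T-statements ("small member `a` at full size": `c < C·(a·rad(bc))^(1+δ)`) and a P-statement.  This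
file proves, UNCONDITIONALLY and for EVERY abc triple, the T-statement with `rad(bc)` replaced by
the `y`-ROUGH PART of `bc` (full multiplicity above `y`),
`rough_y(bc) := ∏_{p > y, p ∣ bc} p^{v_p(bc)}`:

* `ridoutSmallMember_rough`: for every `y` and `δ > 0` there is `C > 0` with
  `c ≤ C·(a·rough_y(bc))^(1+δ)` for every abc triple `(a, b, c)`;
* `ridoutSmallMember_fibre`: its corollary on the COEFFICIENT FIBRES — for every `R` and `δ > 0`
  there is `C > 0` with `rad(bc) ≤ R ⟹ c ≤ C·a^(1+δ)` (on the fibre every prime of `bc` is `≤ R`,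
  so `rough_R(bc) = 1`); this is the conclusion of the landed `stub_fibreBaker` WITHOUT its
  Baker–Wüstholz hypothesis;
* `stub_ridoutSmallMember`: the conjunction (the registered stub of the skeleton
  `Cruxes/DepthCountedABC/Lines/Sketch.lean`).

PROOF.  Fix `y, δ > 0`, put `δ' := δ/(1+δ)` (so `(1+δ)(1−δ') = 1`), take `B` from Ridout
(`DeepRegimeABC.ridoutCoreBound_holds y δ'`: the CORED triples,
`(2+δ') log c ≤ Σ_{p ≤ y} v_p(abc) log p + log(c/min(a,b))`, have `c ≤ B`) and answer
`C := max B 1 · 2^(1+δ)`.  With `X := a·rough_y(bc) ≥ 1`: a cored triple has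
`c ≤ B ≤ C ≤ C·X^(1+δ)`; a CORELESS triple has rough mass
`R_y := Σ_{p > y, p ∣ abc} v_p(abc) log p > (1−δ') log c − log 2`
(`DeepRegimeABC.roughMass_gt_of_coreMass_lt`) and `R_y ≤ log a + log rough_y(bc)`
(`ridoutSmallMember_roughMass_le`: `v_p(abc) = v_p(a) + v_p(bc)`, the `a`-part is `≤ log a`, the
`bc`-part is exactly `log rough_y(bc)`), whence `(1−δ') log c < log(2X)`, `log c < (1+δ) log(2X)`,
`c < (2X)^(1+δ) = 2^(1+δ)·X^(1+δ) ≤ C·X^(1+δ)`.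

Sources: elementary bookkeeping (folklore) over the landed `DeepRegimeABC` lemmas; Ridout's theorem
(Bombieri–Gubler Thm. 6.2.3) enters only through the PROVED `DeepRegimeABC.ridoutCoreBound_holds`;
`log n = Σ_{p ∣ n} v_p(n) log p` is `Literature.Barriers.ABC.log_eq_sum_factorization_mul_log`.
Deliberately NOT here: any claim about the crux itself, about the T core with `rad(bc)` (open), or
about the other stubs of the line; no new definitions are introduced.
-/

-- `Summit.<Summit>.<Problem>` is the mandated summit-side namespace (CONVENTIONS §2); for the
-- single-conjunct summit `ABC` the two coincide, so the duplicate `ABC.ABC` is deliberate.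
set_option linter.dupNamespace false

namespace Summit.ABC.ABC.Theorems.DepthCountedABC

open Literature.NumberTheory.DiophantineGeometry UniqueFactorizationMonoid

/-- **Rough mass bookkeeping.**  For `0 < a` and `0 < bc`, the `y`-rough mass of `abc` is at most
`log a + log rough_y(bc)`:
`Σ_{p > y, p ∣ abc} v_p(abc) log p ≤ log a + log ∏_{p > y, p ∣ bc} p^{v_p(bc)}`
(`v_p(abc) = v_p(a) + v_p(bc)`; the `a`-part is at most `Σ_{p ∣ a} v_p(a) log p = log a`, the
`bc`-part is exactly the logarithm of the rough part). [folklore] -/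
theorem ridoutSmallMember_roughMass_le {a b c : ℕ} (y : ℕ) (ha : 0 < a) (hbc : 0 < b * c) :
    ∑ p ∈ (a * b * c).primeFactors.filter (fun p => ¬ p ≤ y),
        ((a * b * c).factorization p : ℝ) * Real.log p ≤
      Real.log a + Real.log ((∏ p ∈ (b * c).primeFactors.filter (fun p => ¬ p ≤ y),
        p ^ (b * c).factorization p : ℕ) : ℝ) := by
  have ha0 : a ≠ 0 := ha.ne'
  have hbc0 : b * c ≠ 0 := hbc.ne'
  have habc0 : a * (b * c) ≠ 0 := mul_ne_zero ha0 hbc0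
  rw [mul_assoc]
  -- split `v_p(a·bc) = v_p(a) + v_p(bc)`
  have hsplit : ∀ p : ℕ, ((a * (b * c)).factorization p : ℝ) * Real.log p =
      (a.factorization p : ℝ) * Real.log p + ((b * c).factorization p : ℝ) * Real.log p := by
    intro p
    rw [Nat.factorization_mul ha0 hbc0, Finsupp.coe_add, Pi.add_apply, Nat.cast_add, add_mul]
  rw [Finset.sum_congr rfl fun p _ => hsplit p, Finset.sum_add_distrib]
  have hlog0 : ∀ p ∈ (a * (b * c)).primeFactors, (0 : ℝ) ≤ Real.log p := fun p hp =>
    Real.log_nonneg (by exact_mod_cast (Nat.prime_of_mem_primeFactors hp).one_lt.le)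
  -- (i) the `a`-part is at most `log a`
  have hA : ∑ p ∈ (a * (b * c)).primeFactors.filter (fun p => ¬ p ≤ y),
      (a.factorization p : ℝ) * Real.log p ≤ Real.log a := by
    calc ∑ p ∈ (a * (b * c)).primeFactors.filter (fun p => ¬ p ≤ y),
          (a.factorization p : ℝ) * Real.log p
        ≤ ∑ p ∈ (a * (b * c)).primeFactors, (a.factorization p : ℝ) * Real.log p :=
          Finset.sum_le_sum_of_subset_of_nonneg (Finset.filter_subset _ _)
            fun p hp _ => mul_nonneg (Nat.cast_nonneg _) (hlog0 p hp)
      _ = ∑ p ∈ a.primeFactors, (a.factorization p : ℝ) * Real.log p := by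
          refine (Finset.sum_subset (Nat.primeFactors_mono (dvd_mul_right a (b * c)) habc0)
            fun p _ hpa => ?_).symm
          rw [← Nat.support_factorization, Finsupp.notMem_support_iff] at hpa
          rw [hpa, Nat.cast_zero, zero_mul]
      _ = Real.log a := (Literature.Barriers.ABC.log_eq_sum_factorization_mul_log ha0).symm
  -- (ii) the `bc`-part is the logarithm of the rough part
  have hB : ∑ p ∈ (a * (b * c)).primeFactors.filter (fun p => ¬ p ≤ y),
      ((b * c).factorization p : ℝ) * Real.log p =
      Real.log ((∏ p ∈ (b * c).primeFactors.filter (fun p => ¬ p ≤ y),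
        p ^ (b * c).factorization p : ℕ) : ℝ) := by
    have hsub : (b * c).primeFactors.filter (fun p => ¬ p ≤ y) ⊆
        (a * (b * c)).primeFactors.filter (fun p => ¬ p ≤ y) :=
      Finset.filter_subset_filter _ (Nat.primeFactors_mono (dvd_mul_left (b * c) a) habc0)
    rw [← Finset.sum_subset hsub ?_]
    · push_cast
      rw [Real.log_prod]
      · exact Finset.sum_congr rfl fun p _ => by rw [Real.log_pow]
      · intro p hp
        exact pow_ne_zero _ (by
          exact_mod_cast (Nat.prime_of_mem_primeFactors (Finset.mem_filter.1 hp).1).ne_zero)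
    · intro p hp hpn
      have hp' : p ∉ (b * c).primeFactors := fun h =>
        hpn (Finset.mem_filter.2 ⟨h, (Finset.mem_filter.1 hp).2⟩)
      rw [← Nat.support_factorization, Finsupp.notMem_support_iff] at hp'
      rw [hp', Nat.cast_zero, zero_mul]
  linarith [hA, hB]

/-- **The Ridout stratum of the T core: member `a` at full size against the rough part of `bc`.**
For every `y` and `δ > 0` there is `C > 0` such that every abc triple `(a, b, c)` satisfies
`c ≤ C·(a·rough_y(bc))^(1+δ)`, `rough_y(bc) = ∏_{p > y, p ∣ bc} p^{v_p(bc)}`.  With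
`δ' = δ/(1+δ)` and `B` from `DeepRegimeABC.ridoutCoreBound_holds y δ'`, `C := max B 1 · 2^(1+δ)`:
cored triples have `c ≤ B`, coreless ones have `(1−δ') log c − log 2 < R_y ≤ log a + log rough_y(bc)`
(`DeepRegimeABC.roughMass_gt_of_coreMass_lt`, `ridoutSmallMember_roughMass_le`), i.e.
`c < (2·a·rough_y(bc))^(1+δ)`. [cite: BombieriGubler2006, Thm. 6.2.3 with 6.2.5 (K = ℚ); Vojta1987, §3.2] -/
theorem ridoutSmallMember_rough :
    ∀ y : ℕ, ∀ δ : ℝ, 0 < δ → ∃ C : ℝ, 0 < C ∧ ∀ a b c : ℕ, IsABCTriple a b c →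
      (c : ℝ) ≤ C * ((a : ℝ) *
        ((∏ p ∈ (b * c).primeFactors.filter (fun p => ¬ p ≤ y), p ^ (b * c).factorization p : ℕ) :
          ℝ)) ^ (1 + δ) := by
  intro y δ hδ
  have hδ1 : (0 : ℝ) < 1 + δ := by linarith
  -- the parameter `δ' = δ/(1+δ)`, so that `(1+δ)(1-δ') = 1`
  set δ' : ℝ := δ / (1 + δ) with hδ'
  have hδ'0 : 0 < δ' := div_pos hδ hδ1
  have hδ'1 : (1 + δ) * (1 - δ') = 1 := by
    rw [hδ']
    field_simp
    ring
  obtain ⟨B, hB⟩ := DeepRegimeABC.ridoutCoreBound_holds y δ' hδ'0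
  have h2δ : (1 : ℝ) ≤ (2 : ℝ) ^ (1 + δ) := Real.one_le_rpow (by norm_num) hδ1.le
  have hB1 : (1 : ℝ) ≤ max B 1 := le_max_right _ _
  have hB0 : (0 : ℝ) ≤ max B 1 := zero_le_one.trans hB1
  set C : ℝ := max B 1 * (2 : ℝ) ^ (1 + δ) with hC
  have hBC : max B 1 ≤ C := le_mul_of_one_le_right hB0 h2δ
  have hC0 : (0 : ℝ) < C := by linarith
  refine ⟨C, hC0, fun a b c habc => ?_⟩
  obtain ⟨ha, hb, hsum, -⟩ := id habc
  have hc : 0 < c := by omega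
  have hcR : (0 : ℝ) < (c : ℝ) := by exact_mod_cast hc
  have hbc : 0 < b * c := Nat.mul_pos hb hc
  -- the rough part of `bc` and `X = a · rough ≥ 1`
  have hM := ridoutSmallMember_roughMass_le y ha hbc
  have hrough0 : 0 < ∏ p ∈ (b * c).primeFactors.filter (fun p => ¬ p ≤ y),
      p ^ (b * c).factorization p :=
    Finset.prod_pos fun p hp =>
      pow_pos (Nat.prime_of_mem_primeFactors (Finset.mem_filter.1 hp).1).pos _
  generalize (∏ p ∈ (b * c).primeFactors.filter (fun p => ¬ p ≤ y),
      p ^ (b * c).factorization p) = rough at hM hrough0 ⊢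
  have ha1 : (1 : ℝ) ≤ (a : ℝ) := by exact_mod_cast ha
  have hr1 : (1 : ℝ) ≤ (rough : ℝ) := by exact_mod_cast hrough0
  have hX1 : (1 : ℝ) ≤ (a : ℝ) * (rough : ℝ) := by nlinarith
  have hX0 : (0 : ℝ) < (a : ℝ) * (rough : ℝ) := by linarith
  have hXδ1 : (1 : ℝ) ≤ ((a : ℝ) * (rough : ℝ)) ^ (1 + δ) := Real.one_le_rpow hX1 hδ1.le
  by_cases hcore :
      (∑ p ∈ (a * b * c).primeFactors.filter (fun p => p ≤ y),
            ((a * b * c).factorization p : ℝ) * Real.log p)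
          + Real.log ((c : ℝ) / ((min a b : ℕ) : ℝ)) < (2 + δ') * Real.log c
  · -- CORELESS: `(1-δ') log c - log 2 < R_y ≤ log a + log rough`, so `c < (2·a·rough)^(1+δ)`
    have hR := DeepRegimeABC.roughMass_gt_of_coreMass_lt (y := y) habc hcore
    have hlog2X : Real.log (2 * ((a : ℝ) * (rough : ℝ))) =
        Real.log 2 + Real.log a + Real.log (rough : ℝ) := by
      rw [Real.log_mul (by norm_num) hX0.ne', Real.log_mul (by positivity) (by positivity)]
      ring
    have hlt : Real.log c < (1 + δ) * Real.log (2 * ((a : ℝ) * (rough : ℝ))) := by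
      have h1 : (1 - δ') * Real.log c < Real.log (2 * ((a : ℝ) * (rough : ℝ))) := by
        rw [hlog2X]
        linarith
      have h2 := mul_lt_mul_of_pos_left h1 hδ1
      rwa [← mul_assoc, hδ'1, one_mul] at h2
    have hclt : (c : ℝ) < (2 * ((a : ℝ) * (rough : ℝ))) ^ (1 + δ) :=
      (Real.lt_rpow_iff_log_lt hcR (by positivity)).2 hlt
    calc (c : ℝ) ≤ (2 * ((a : ℝ) * (rough : ℝ))) ^ (1 + δ) := hclt.le
      _ = (2 : ℝ) ^ (1 + δ) * ((a : ℝ) * (rough : ℝ)) ^ (1 + δ) :=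
          Real.mul_rpow (by norm_num) hX0.le
      _ = 1 * ((2 : ℝ) ^ (1 + δ) * ((a : ℝ) * (rough : ℝ)) ^ (1 + δ)) := (one_mul _).symm
      _ ≤ max B 1 * ((2 : ℝ) ^ (1 + δ) * ((a : ℝ) * (rough : ℝ)) ^ (1 + δ)) :=
          mul_le_mul_of_nonneg_right hB1 (by positivity)
      _ = C * ((a : ℝ) * (rough : ℝ)) ^ (1 + δ) := by rw [hC, mul_assoc]
  · -- CORED: bounded by Ridout (`ridoutCoreBound_holds`), absorbed since `X^(1+δ) ≥ 1`
    calc (c : ℝ) ≤ B := hB a b c habc (not_lt.mp hcore)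
      _ ≤ max B 1 := le_max_left _ _
      _ ≤ C := hBC
      _ ≤ C * ((a : ℝ) * (rough : ℝ)) ^ (1 + δ) := le_mul_of_one_le_right hC0.le hXδ1

/-- **The coefficient fibres of the T core, unconditionally.**  For every `R` and `δ > 0` there is
`C > 0` such that every abc triple `(a, b, c)` with `rad(bc) ≤ R` satisfies `c ≤ C·a^(1+δ)`:
on the fibre every prime `p ∣ bc` divides `rad(bc) ≤ R` (`Nat.primeFactors_radical`), so the
`R`-rough part of `bc` is the empty product and `ridoutSmallMember_rough` at `y := R` is the claim.
[cite: BombieriGubler2006, Thm. 6.2.3 with 6.2.5 (K = ℚ); Vojta1987, §3.2] -/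
theorem ridoutSmallMember_fibre :
    ∀ R : ℕ, ∀ δ : ℝ, 0 < δ → ∃ C : ℝ, 0 < C ∧ ∀ a b c : ℕ, IsABCTriple a b c →
      radical (b * c) ≤ R → (c : ℝ) ≤ C * (a : ℝ) ^ (1 + δ) := by
  intro R δ hδ
  obtain ⟨C, hC, h⟩ := ridoutSmallMember_rough R δ hδ
  refine ⟨C, hC, fun a b c habc hR => ?_⟩
  have hempty : (b * c).primeFactors.filter (fun p => ¬ p ≤ R) = ∅ := by
    refine Finset.filter_eq_empty_iff.2 fun p hp hnot => hnot ?_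
    rw [← Nat.primeFactors_radical] at hp
    exact (Nat.le_of_mem_primeFactors hp).trans hR
  have hb := h a b c habc
  rwa [hempty, Finset.prod_empty, Nat.cast_one, mul_one] at hb

/-- **Stub `stub_ridoutSmallMember` — the Ridout stratum of the T core.**  (1) For every `y` and
`δ > 0` there is `C > 0` with `c ≤ C·(a·rough_y(bc))^(1+δ)` for EVERY abc triple, where
`rough_y(bc) = ∏_{p > y, p ∣ bc} p^{v_p(bc)}` is the `y`-rough part of `bc` (T with `rad(bc)`
replaced by the rough part, full multiplicity); (2) on the coefficient fibres `rad(bc) ≤ R`,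
`c ≤ C(R, δ)·a^(1+δ)`.  Ridout's `p`-adic Roth theorem over `ℚ` enters through the landed
`DeepRegimeABC.ridoutCoreBound_holds`; the rest is mass bookkeeping.
[cite: BombieriGubler2006, Thm. 6.2.3 with 6.2.5 (K = ℚ); Vojta1987, §3.2] -/
theorem stub_ridoutSmallMember :
    (∀ y : ℕ, ∀ δ : ℝ, 0 < δ → ∃ C : ℝ, 0 < C ∧ ∀ a b c : ℕ,
      Literature.NumberTheory.DiophantineGeometry.IsABCTriple a b c →
      (c : ℝ) ≤ C * ((a : ℝ) *
        ((∏ p ∈ (b * c).primeFactors.filter (fun p => ¬ p ≤ y), p ^ (b * c).factorization p : ℕ) : ℝ)) ^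
          (1 + δ)) ∧
    (∀ R : ℕ, ∀ δ : ℝ, 0 < δ → ∃ C : ℝ, 0 < C ∧ ∀ a b c : ℕ,
      Literature.NumberTheory.DiophantineGeometry.IsABCTriple a b c →
      UniqueFactorizationMonoid.radical (b * c) ≤ R → (c : ℝ) ≤ C * (a : ℝ) ^ (1 + δ)) :=
  ⟨ridoutSmallMember_rough, ridoutSmallMember_fibre⟩

end Summit.ABC.ABC.Theorems.DepthCountedABC
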